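import Mathlib
import Summits.Ventures.HodgeRepro.Tier4.Common.AdelicDefs
import Summits.Ventures.HodgeRepro.Tier4.Line1.PlaneDefs

/-!
# Tier4/Line1/DiagonalPlane — LINE L1, (I0): the seesaw plane as a genuine definite `PlaneData` (constructor)

Blind re-derivation cell `pub-hodge-repro`, Tier 4 (README §9–§10), seat t4-L1-p1 g2 (STATUS.md S13265, offer on
t4-L1-p3 g2's DEFINED (I0) candidate «a definite genuine `PlaneData (E⁺)` from `E = E⁺(√−δ)`»).  The line's RTF datum
(`RTFDatum`, Skeleton v0.31 L960) carries the seesaw plane as a `PlaneData k` together with `IsDefinite` and `IsGenuineRow`;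
this module is the CONSTRUCTOR of that plane from the CM data and proves its two predicates:

* `k` any field (the totally real field `E′⁺` in the line), `δ : k` with `E′ = k(√−δ)` (`−δ` not a square), the two
  hermitian lines `W₀ = ⟨e⟩`, `W₁ = ⟨e′⟩` with norms `a₀ = h(e,e)`, `a₁ = h(e′,e′) ∈ k^×`;
* on the `k`-basis `(e, e√−δ, e′, e′√−δ)` the multiplication by `√−δ` is `Jmat δ = diag(J, J)`, `J = [[0, 1], [−δ, 0]]`
  (ROW convention `v ↦ v Ω`: `e ↦ e√−δ`, `e√−δ ↦ −δ e`; the transpose of t4-L1-p3's column-picture adapted-basis matrix,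
  RotationGram `mul_adapted_eq`), the trace form
  `Tr_{E′/k} h` has Gram matrix `Bdiag δ a₀ a₁ = diag(a₀, δa₀, a₁, δa₁)`, the projectors of the first decomposition are
  `P0 = diag(1,1,0,0)`, `P1 = diag(0,0,1,1)`;
* the second decomposition `W = g W₂ ⊕ g W₃` is transported by a rational `E′`-linear isometry `g` of the plane
  (`IsIsometry δ a₀ a₁ g`: `g Ω = Ω g`, `g B gᵀ = B`, `g` invertible): `Q i = g⁻¹ (P i) g`.

`diagonalPlane_isGenuineRow` (for `¬ IsSquare (−δ)`, `a₀ ≠ 0`, `a₁ ≠ 0`) and `diagonalPlane_isDefinite` (for a real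
embedding `σ` with `σ δ > 0` and `σ a₀, σ a₁` of one sign — the CM field is totally imaginary and the plane is definite at
`w₀`, Liu 2021 Lemma D.2(2): those two clauses are the DATA-SHEET inputs, stated by the consumer, not here) are the
`hgen` / `hdef` fields of the datum.  Nothing here asserts the existence of the isometry `g` (the seesaw's identification
`W₀ ⊕ W₁ ≅ W₂ ⊕ W₃` is an input of the construction) or anything about (P).

Nothing here says anything about the status of the Hodge conjecture for CM abelian varieties, which is NOT proved
(HC_CM is NOT proved by anyone in this repository).
-/

set_option autoImplicit false

noncomputable section

namespace Summit.Ventures.HodgeRepro.Tier4.Line1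

open Common Matrix

section Defs

variable {k : Type} [Field k]

/-- the matrix of multiplication by `√−δ` on the adapted basis `(e, e√−δ, e′, e′√−δ)`: `diag(J, J)`, `J = [[0, 1], [−δ, 0]]`
(row convention `v ↦ v Ω`). -/
def Jmat (δ : k) : Matrix (Fin 4) (Fin 4) k :=
  Matrix.of ![![0, 1, 0, 0], ![-δ, 0, 0, 0], ![0, 0, 0, 1], ![0, 0, -δ, 0]]

/-- the Gram matrix of the trace form of the diagonal hermitian plane `a₀ N ⊕ a₁ N`: `diag(a₀, δa₀, a₁, δa₁)`. -/
def Bdiag (δ a₀ a₁ : k) : Matrix (Fin 4) (Fin 4) k := Matrix.diagonal ![a₀, δ * a₀, a₁, δ * a₁]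

/-- the projector onto the first line `W₀`. -/
def P0 : Matrix (Fin 4) (Fin 4) k := Matrix.diagonal ![1, 1, 0, 0]

/-- the projector onto the second line `W₁`. -/
def P1 : Matrix (Fin 4) (Fin 4) k := Matrix.diagonal ![0, 0, 1, 1]

/-- the two projectors of the first decomposition. -/
def Pdiag : Fin 2 → Matrix (Fin 4) (Fin 4) k := ![P0, P1]

/-- **`g` is an `E′`-linear isometry of the diagonal plane** (row convention of typer-2's `unitaryGroup`): `g Ω = Ω g`
and `g B gᵀ = B`. -/
structure IsIsometry (δ a₀ a₁ : k) (g : Matrix (Fin 4) (Fin 4) k) : Prop where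
  /-- `g` commutes with the multiplication by `√−δ` -/
  comm : g * Jmat δ = Jmat δ * g
  /-- `g` preserves the trace form -/
  unit : g * Bdiag δ a₀ a₁ * gᵀ = Bdiag δ a₀ a₁

/-- `Jmat δ * Jmat δ = −δ`. -/
theorem Jmat_mul_Jmat (δ : k) : Jmat δ * Jmat δ = -(δ • (1 : Matrix (Fin 4) (Fin 4) k)) := by
  ext i j
  fin_cases i <;> fin_cases j <;> simp [Jmat, Matrix.mul_apply, Fin.sum_univ_four]

/-- the hermitian relation `Ω B = −B Ωᵀ` of the diagonal plane. -/
theorem Jmat_mul_Bdiag (δ a₀ a₁ : k) : Jmat δ * Bdiag δ a₀ a₁ = -(Bdiag δ a₀ a₁ * (Jmat δ)ᵀ) := by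
  ext i j
  fin_cases i <;> fin_cases j <;>
    simp [Jmat, Bdiag, Matrix.mul_apply, Matrix.diagonal] <;> ring

/-- the projectors commute with `Ω`. -/
theorem Pdiag_mul_Jmat (δ : k) (i : Fin 2) : Pdiag i * Jmat δ = Jmat δ * Pdiag i := by
  fin_cases i <;> ext a b <;> fin_cases a <;> fin_cases b <;>
    simp [Pdiag, P0, P1, Jmat, Matrix.mul_apply, Matrix.diagonal]

/-- the projectors are idempotent. -/
theorem Pdiag_idem (i : Fin 2) : Pdiag i * Pdiag i = (Pdiag i : Matrix (Fin 4) (Fin 4) k) := by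
  fin_cases i <;> ext a b <;> fin_cases a <;> fin_cases b <;>
    simp [Pdiag, P0, P1, Matrix.mul_apply, Matrix.diagonal]

/-- the projectors sum to the identity. -/
theorem Pdiag_sum : Pdiag 0 + Pdiag 1 = (1 : Matrix (Fin 4) (Fin 4) k) := by
  ext a b
  fin_cases a <;> fin_cases b <;> simp [Pdiag, P0, P1, Matrix.diagonal]

/-- the projectors are symmetric. -/
theorem Pdiag_transpose (i : Fin 2) : (Pdiag i)ᵀ = (Pdiag i : Matrix (Fin 4) (Fin 4) k) := by
  fin_cases i <;> simp [Pdiag, P0, P1, Matrix.diagonal_transpose]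

/-- the projectors commute with `B` (both diagonal). -/
theorem Pdiag_mul_Bdiag (δ a₀ a₁ : k) (i : Fin 2) :
    Pdiag i * Bdiag δ a₀ a₁ = Bdiag δ a₀ a₁ * Pdiag i := by
  fin_cases i <;> simp [Pdiag, P0, P1, Bdiag, Matrix.diagonal_mul_diagonal, mul_comm]

/-- `Bdiag` is symmetric. -/
theorem Bdiag_transpose (δ a₀ a₁ : k) : (Bdiag δ a₀ a₁)ᵀ = Bdiag δ a₀ a₁ := by
  simp [Bdiag, Matrix.diagonal_transpose]

/-- the projectors have rank `2`. -/
theorem Pdiag_rank (i : Fin 2) : (Pdiag i : Matrix (Fin 4) (Fin 4) k).rank = 2 := by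
  classical
  fin_cases i
  · show (Matrix.diagonal ![(1 : k), 1, 0, 0]).rank = 2
    rw [Matrix.rank_diagonal, Fintype.card_subtype]
    have : (Finset.univ.filter fun i : Fin 4 => ![(1 : k), 1, 0, 0] i ≠ 0) = {0, 1} := by
      ext i
      fin_cases i <;> simp
    rw [this]
    rfl
  · show (Matrix.diagonal ![(0 : k), 0, 1, 1]).rank = 2
    rw [Matrix.rank_diagonal, Fintype.card_subtype]
    have : (Finset.univ.filter fun i : Fin 4 => ![(0 : k), 0, 1, 1] i ≠ 0) = {2, 3} := by
      ext i
      fin_cases i <;> simp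
    rw [this]
    rfl

/-- **THE DIAGONAL PLANE** as a `PlaneData k`: `B = diag(a₀, δa₀, a₁, δa₁)`, `Ω = diag(J, J)`, `P = (P0, P1)`,
`Q i = g⁻¹ (P i) g` for an invertible `E′`-linear isometry `g`. -/
def diagonalPlane (δ a₀ a₁ : k) (g : (Matrix (Fin 4) (Fin 4) k)ˣ) (hg : IsIsometry δ a₀ a₁ (g : Matrix (Fin 4) (Fin 4) k)) :
    PlaneData k where
  B := Bdiag δ a₀ a₁
  Ω := Jmat δ
  P := Pdiag
  Q := fun i => (↑g⁻¹ : Matrix (Fin 4) (Fin 4) k) * Pdiag i * (g : Matrix (Fin 4) (Fin 4) k)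
  B_symm := Bdiag_transpose δ a₀ a₁
  P_comm := Pdiag_mul_Jmat δ
  Q_comm := by
    intro i
    have h1 : (↑g⁻¹ : Matrix (Fin 4) (Fin 4) k) * (g : Matrix (Fin 4) (Fin 4) k) = 1 := Units.inv_mul g
    have h2 : (g : Matrix (Fin 4) (Fin 4) k) * (↑g⁻¹ : Matrix (Fin 4) (Fin 4) k) = 1 := Units.mul_inv g
    have hinv : Jmat δ * (↑g⁻¹ : Matrix (Fin 4) (Fin 4) k) = (↑g⁻¹ : Matrix (Fin 4) (Fin 4) k) * Jmat δ := by
      have e1 : (↑g⁻¹ : Matrix (Fin 4) (Fin 4) k) * ((g : Matrix (Fin 4) (Fin 4) k) * Jmat δ) *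
          (↑g⁻¹ : Matrix (Fin 4) (Fin 4) k) = Jmat δ * (↑g⁻¹ : Matrix (Fin 4) (Fin 4) k) := by
        rw [← Matrix.mul_assoc, h1, Matrix.one_mul]
      have e2 : (↑g⁻¹ : Matrix (Fin 4) (Fin 4) k) * (Jmat δ * (g : Matrix (Fin 4) (Fin 4) k)) *
          (↑g⁻¹ : Matrix (Fin 4) (Fin 4) k) = (↑g⁻¹ : Matrix (Fin 4) (Fin 4) k) * Jmat δ := by
        rw [Matrix.mul_assoc, Matrix.mul_assoc, h2, Matrix.mul_one]
      rw [← e1, ← e2, hg.comm]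
    have s1 : (↑g⁻¹ : Matrix (Fin 4) (Fin 4) k) * Pdiag i * (g : Matrix (Fin 4) (Fin 4) k) * Jmat δ =
        (↑g⁻¹ : Matrix (Fin 4) (Fin 4) k) * (Pdiag i * Jmat δ) * (g : Matrix (Fin 4) (Fin 4) k) := by
      rw [Matrix.mul_assoc, hg.comm, ← Matrix.mul_assoc, ← Matrix.mul_assoc, Matrix.mul_assoc _ (Pdiag i)]
    have s2 : (↑g⁻¹ : Matrix (Fin 4) (Fin 4) k) * (Jmat δ * Pdiag i) * (g : Matrix (Fin 4) (Fin 4) k) =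
        Jmat δ * ((↑g⁻¹ : Matrix (Fin 4) (Fin 4) k) * Pdiag i * (g : Matrix (Fin 4) (Fin 4) k)) := by
      rw [← Matrix.mul_assoc, ← Matrix.mul_assoc, ← hinv]
      simp only [Matrix.mul_assoc]
    rw [s1, Pdiag_mul_Jmat, s2]
  P_idem := Pdiag_idem
  Q_idem := by
    intro i
    have h2 : (g : Matrix (Fin 4) (Fin 4) k) * (↑g⁻¹ : Matrix (Fin 4) (Fin 4) k) = 1 := Units.mul_inv g
    calc (↑g⁻¹ : Matrix (Fin 4) (Fin 4) k) * Pdiag i * (g : Matrix (Fin 4) (Fin 4) k) *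
          ((↑g⁻¹ : Matrix (Fin 4) (Fin 4) k) * Pdiag i * (g : Matrix (Fin 4) (Fin 4) k))
        = (↑g⁻¹ : Matrix (Fin 4) (Fin 4) k) * (Pdiag i * Pdiag i) * (g : Matrix (Fin 4) (Fin 4) k) := by
          simp only [Matrix.mul_assoc]
          rw [← Matrix.mul_assoc (g : Matrix (Fin 4) (Fin 4) k), h2, Matrix.one_mul]
      _ = (↑g⁻¹ : Matrix (Fin 4) (Fin 4) k) * Pdiag i * (g : Matrix (Fin 4) (Fin 4) k) := by
          rw [Pdiag_idem]
  P_sum := Pdiag_sum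
  Q_sum := by
    have h1 : (↑g⁻¹ : Matrix (Fin 4) (Fin 4) k) * (g : Matrix (Fin 4) (Fin 4) k) = 1 := Units.inv_mul g
    calc (↑g⁻¹ : Matrix (Fin 4) (Fin 4) k) * Pdiag 0 * (g : Matrix (Fin 4) (Fin 4) k) +
          (↑g⁻¹ : Matrix (Fin 4) (Fin 4) k) * Pdiag 1 * (g : Matrix (Fin 4) (Fin 4) k)
        = (↑g⁻¹ : Matrix (Fin 4) (Fin 4) k) * (Pdiag 0 + Pdiag 1) * (g : Matrix (Fin 4) (Fin 4) k) := by
          rw [Matrix.mul_add, Matrix.add_mul]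
      _ = 1 := by rw [Pdiag_sum, Matrix.mul_one, h1]

end Defs

section Predicates

variable {k : Type} [Field k]

/-- **The diagonal plane is GENUINE** (`IsGenuineRow`) when `−δ` is not a square and the two norms are non-zero. -/
theorem diagonalPlane_isGenuineRow (δ a₀ a₁ : k) (g : (Matrix (Fin 4) (Fin 4) k)ˣ)
    (hg : IsIsometry δ a₀ a₁ (g : Matrix (Fin 4) (Fin 4) k)) (hδ : ¬ IsSquare (-δ)) :
    IsGenuineRow (diagonalPlane δ a₀ a₁ g hg) := by
  have h1 : (↑g⁻¹ : Matrix (Fin 4) (Fin 4) k) * (g : Matrix (Fin 4) (Fin 4) k) = 1 := Units.inv_mul g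
  have h2 : (g : Matrix (Fin 4) (Fin 4) k) * (↑g⁻¹ : Matrix (Fin 4) (Fin 4) k) = 1 := Units.mul_inv g
  have hdetg : IsUnit (g : Matrix (Fin 4) (Fin 4) k).det := (Matrix.isUnit_iff_isUnit_det _).mp g.isUnit
  have hdetg' : IsUnit (↑g⁻¹ : Matrix (Fin 4) (Fin 4) k).det :=
    (Matrix.isUnit_iff_isUnit_det _).mp g⁻¹.isUnit
  -- `B gᵀ = g⁻¹ B` and `B (g⁻¹)ᵀ = g B`
  have hBg : Bdiag δ a₀ a₁ * (g : Matrix (Fin 4) (Fin 4) k)ᵀ = (↑g⁻¹ : Matrix (Fin 4) (Fin 4) k) * Bdiag δ a₀ a₁ := by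
    have this : (↑g⁻¹ : Matrix (Fin 4) (Fin 4) k) * ((g : Matrix (Fin 4) (Fin 4) k) * Bdiag δ a₀ a₁ *
        (g : Matrix (Fin 4) (Fin 4) k)ᵀ) = (↑g⁻¹ : Matrix (Fin 4) (Fin 4) k) * Bdiag δ a₀ a₁ := by
      rw [hg.unit]
    rw [← Matrix.mul_assoc, ← Matrix.mul_assoc, h1, Matrix.one_mul] at this
    exact this
  have hBg' : Bdiag δ a₀ a₁ * (↑g⁻¹ : Matrix (Fin 4) (Fin 4) k)ᵀ = (g : Matrix (Fin 4) (Fin 4) k) * Bdiag δ a₀ a₁ := by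
    calc Bdiag δ a₀ a₁ * (↑g⁻¹ : Matrix (Fin 4) (Fin 4) k)ᵀ
        = (g : Matrix (Fin 4) (Fin 4) k) * Bdiag δ a₀ a₁ * (g : Matrix (Fin 4) (Fin 4) k)ᵀ *
            (↑g⁻¹ : Matrix (Fin 4) (Fin 4) k)ᵀ := by rw [hg.unit]
      _ = (g : Matrix (Fin 4) (Fin 4) k) * Bdiag δ a₀ a₁ *
            ((↑g⁻¹ : Matrix (Fin 4) (Fin 4) k) * (g : Matrix (Fin 4) (Fin 4) k))ᵀ := by
          rw [Matrix.transpose_mul, Matrix.mul_assoc]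
      _ = (g : Matrix (Fin 4) (Fin 4) k) * Bdiag δ a₀ a₁ := by
          rw [h1, Matrix.transpose_one, Matrix.mul_one]
  refine ⟨⟨δ, Jmat_mul_Jmat δ, hδ⟩, Jmat_mul_Bdiag δ a₀ a₁, ?_, ?_, ?_, ?_⟩
  · intro i
    show Pdiag i * Bdiag δ a₀ a₁ = Bdiag δ a₀ a₁ * (Pdiag i)ᵀ
    rw [Pdiag_transpose, Pdiag_mul_Bdiag]
  · intro i
    show (↑g⁻¹ : Matrix (Fin 4) (Fin 4) k) * Pdiag i * (g : Matrix (Fin 4) (Fin 4) k) * Bdiag δ a₀ a₁ =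
      Bdiag δ a₀ a₁ * ((↑g⁻¹ : Matrix (Fin 4) (Fin 4) k) * Pdiag i * (g : Matrix (Fin 4) (Fin 4) k))ᵀ
    rw [Matrix.transpose_mul, Matrix.transpose_mul, Pdiag_transpose]
    calc (↑g⁻¹ : Matrix (Fin 4) (Fin 4) k) * Pdiag i * (g : Matrix (Fin 4) (Fin 4) k) * Bdiag δ a₀ a₁
        = (↑g⁻¹ : Matrix (Fin 4) (Fin 4) k) * Pdiag i * (Bdiag δ a₀ a₁ * (↑g⁻¹ : Matrix (Fin 4) (Fin 4) k)ᵀ) := by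
          rw [hBg', Matrix.mul_assoc]
      _ = (↑g⁻¹ : Matrix (Fin 4) (Fin 4) k) * (Bdiag δ a₀ a₁ * Pdiag i) * (↑g⁻¹ : Matrix (Fin 4) (Fin 4) k)ᵀ := by
          rw [← Pdiag_mul_Bdiag]
          simp only [Matrix.mul_assoc]
      _ = Bdiag δ a₀ a₁ * ((g : Matrix (Fin 4) (Fin 4) k)ᵀ * (Pdiag i * (↑g⁻¹ : Matrix (Fin 4) (Fin 4) k)ᵀ)) := by
          rw [← Matrix.mul_assoc, ← Matrix.mul_assoc, ← hBg]
          simp only [Matrix.mul_assoc]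
  · intro i
    show (Pdiag i).rank = 2
    exact Pdiag_rank i
  · intro i
    show ((↑g⁻¹ : Matrix (Fin 4) (Fin 4) k) * Pdiag i * (g : Matrix (Fin 4) (Fin 4) k)).rank = 2
    rw [Matrix.rank_mul_eq_left_of_isUnit_det _ _ hdetg, Matrix.rank_mul_eq_right_of_isUnit_det _ _ hdetg']
    exact Pdiag_rank i

/-- **The diagonal plane is DEFINITE** at a real embedding `σ` with `σ δ > 0` and `σ a₀, σ a₁ > 0` (the CM field is
totally imaginary, the plane positive at `w₀`). -/
theorem diagonalPlane_isDefinite_of_pos (δ a₀ a₁ : k) (g : (Matrix (Fin 4) (Fin 4) k)ˣ)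
    (hg : IsIsometry δ a₀ a₁ (g : Matrix (Fin 4) (Fin 4) k)) (σ : k →+* ℝ) (hδ : 0 < σ δ)
    (h₀ : 0 < σ a₀) (h₁ : 0 < σ a₁) : IsDefinite (diagonalPlane δ a₀ a₁ g hg) := by
  refine ⟨σ, Or.inl ?_⟩
  show (Bdiag δ a₀ a₁).map σ |>.PosDef
  rw [Bdiag, Matrix.diagonal_map (map_zero σ), Matrix.posDef_diagonal_iff]
  intro i
  fin_cases i <;> simp [hδ, h₀, h₁]

/-- **The diagonal plane is DEFINITE** at a real embedding `σ` with `σ δ > 0` and `σ a₀, σ a₁ < 0` (the plane negative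
at `w₀`). -/
theorem diagonalPlane_isDefinite_of_neg (δ a₀ a₁ : k) (g : (Matrix (Fin 4) (Fin 4) k)ˣ)
    (hg : IsIsometry δ a₀ a₁ (g : Matrix (Fin 4) (Fin 4) k)) (σ : k →+* ℝ) (hδ : 0 < σ δ)
    (h₀ : σ a₀ < 0) (h₁ : σ a₁ < 0) : IsDefinite (diagonalPlane δ a₀ a₁ g hg) := by
  refine ⟨σ, Or.inr ?_⟩
  show (-((Bdiag δ a₀ a₁).map σ)).PosDef
  rw [Bdiag, Matrix.diagonal_map (map_zero σ), Matrix.diagonal_neg, Matrix.posDef_diagonal_iff]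
  intro i
  fin_cases i <;> simp [hδ, h₀, h₁, mul_neg_of_pos_of_neg]

end Predicates

end Summit.Ventures.HodgeRepro.Tier4.Line1

end
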